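import Summits.CriticalPhenomena.SAWScalingLimit.Theorems.SAWDevelopingMapHexConjectureWindowFloorData
import HarnessLib

/-!
# Crux `HexConjecture` (stmt-CriticalPhenomena-0808), line `root-locality-replaces-loewner`:
the window maximiser of the bootstrap from the WINDOW INEQUALITY along the discretisation families

Landing target:
`Summits/CriticalPhenomena/SAWScalingLimit/Theorems/SAWDevelopingMapHexConjectureWindowIneqMaximiser.lean`
(`--supports stmt-CriticalPhenomena-0808`; lead continuation prover-line-stmt-CriticalPhenomena-0808-c6-0).

The c5 window maximiser (`windowMaximiser`, `…HexConjectureWindowFloorData.lean`) derives, eventually along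
`δ → 0⁺`, a lattice floor point `t = s_{x + d e₀}` of the window `θ₁ ρ₂/δ ≤ d ≤ θ₀ ρ₂/δ` with
`(1 - η) Z_{Λ δ}(a δ, t) ≤ Z_{Λ' δ}(a δ, t)` from the BODY of the window-averaged arch locality (quantified over
all radii, roots, domains `L`, half-boxes `B` and windows `S`).  The c6 reshape of the bootstrap feeds it the
weaker, instance-level WINDOW INEQUALITY instead: eventually along `δ → 0⁺`, for the actual family `Λ δ` and
the actual root `a δ = s_x`,
`Σ_{d ∈ S} Far^{ρ₂/δ}_{Λ δ}(s_x → s_{x + d e₀}) ≤ η · Σ_{d ∈ S} Z_{Λ δ}(s_x → s_{x + d e₀})`,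
`S = Icc ⌈θ₁ ρ₂/δ⌉ ⌊θ₀ ρ₂/δ⌋`, with `Z_{Λ δ}` itself (not a half-box) on the right.
* `exists_window_point_self`: the abstract selection with `Z_B := Z` — termwise `Z ≤ Z' + F`, `η ≥ 0` and
  `Σ_S F ≤ η Σ_S Z` over a nonempty window give a point with `(1 - η) Z ≤ Z'` (pigeonhole).
* `windowMaximiser_of_windowIneq`: c5's proof with the half-box deleted — the floor form `a δ = s_x` of the
  root (`floorEdge_data`), the window `S` (nonempty once `δ ≤ (θ₀ - θ₁) ρ₂`) inside the rigid ball (so every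
  window point is a boundary mid-edge of both families with nonempty walk spaces), exact restriction
  (`archMass_le_archMass_add_farMass`: a walk of `Λ δ` leaving `Λ' δ` reaches lattice distance `≥ ρ₂/δ` from
  the root, since the two families agree in the rigid ball), the window inequality at the root cell `x`, and
  the selection `exists_window_point_self`.
Registered forms: `stub_existsWindowPointSelf`, `stub_windowMaximiserOfWindowIneq`.
Sources: LawlerSchrammWerner2004SAW (§3.4, "SAW satisfies restriction").
-/

noncomputable section

open scoped BigOperators Topology Classical
open Filter Set Metric
open Literature.Probability.LatticeModels (HexVertex hexGraph hexCenter Site)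
open Literature.Probability.RandomPlanarGeometry
open Literature.Probability.RandomPlanarGeometry.SAW
open Summit.CriticalPhenomena.SAWScalingLimit.Theorems.ObservableToSLE.FloorRatio

namespace Summit.CriticalPhenomena.SAWScalingLimit.Theorems.HexConjecture.RootLocality

/-! ### The abstract selection with `Z_B := Z` -/

/-- **The window point of the bootstrap, self form.**  If termwise `Z ≤ Z' + F` (exact restriction: a
walk not in the subdomain is far), `η ≥ 0`, and the window inequality `Σ_S F ≤ η Σ_S Z` holds over a
nonempty window `S`, then at some point of the window `(1 - η) Z ≤ Z'`.
[cite: LawlerSchrammWerner2004SAW, §3.4 ("SAW satisfies restriction")] -/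
theorem exists_window_point_self {S : Finset ℤ} (hS : S.Nonempty) {Z Z' F : ℤ → ℝ} {η : ℝ}
    (hη : 0 ≤ η) (hsplit : ∀ d ∈ S, Z d ≤ Z' d + F d)
    (hW : ∑ d ∈ S, F d ≤ η * ∑ d ∈ S, Z d) : ∃ d ∈ S, (1 - η) * Z d ≤ Z' d :=
  exists_window_point hS (ZB := Z) hη hsplit (fun _ _ => le_rfl) hW

/-- **Registered sub-goal `stub_existsWindowPointSelf`** (crux item stmt-CriticalPhenomena-0808, line
`root-locality-replaces-loewner`, lead continuation c6): the abstract selection of the window point with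
`Z_B := Z` (`exists_window_point_self`). [folklore] -/
theorem stub_existsWindowPointSelf : ∀ (S : Finset ℤ), S.Nonempty → ∀ (Z Z' F : ℤ → ℝ) (η : ℝ), 0 ≤ η → (∀ d ∈ S, Z d ≤ Z' d + F d) → ∑ d ∈ S, F d ≤ η * ∑ d ∈ S, Z d → ∃ d ∈ S, (1 - η) * Z d ≤ Z' d :=
  fun _ hS _ _ _ _ hη hsplit hW => exists_window_point_self hS hη hsplit hW

/-! ### The window maximiser from the window inequality -/

/-- **THE WINDOW MAXIMISER FROM THE WINDOW INEQUALITY.**  See the module docstring.  Hypotheses: the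
admissibility clause of the mechanism stub (eventually along `δ → 0⁺`), the root limit `δ·mid(a δ) → a`, a
radius `0 < ρ₂ ≤ ρ/2`, window parameters `0 < θ₁ < θ₀ ≤ 1/2`, a ratio `η ≥ 0`, and, eventually along
`δ → 0⁺`, the window inequality for `Λ δ` at every floor form `s_x` of the root `a δ` on the row `m δ`.
Conclusion: eventually there are a root cell `x` (`a δ = s_x`, `x₁ = m δ`) and an offset `d` in the window
`[θ₁ ρ₂/δ, θ₀ ρ₂/δ]` such that the floor mid-edge `t = s_{x + d e₀}` is a boundary mid-edge of `Λ δ` and of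
`Λ' δ` with nonempty walk spaces from `a δ`, and `(1 - η) · Z_{Λ δ}(a δ, t) ≤ Z_{Λ' δ}(a δ, t)`.
[cite: LawlerSchrammWerner2004SAW, §3.4 ("SAW satisfies restriction")] -/
theorem windowMaximiser_of_windowIneq (D D' : DobrushinDomain) (ρ : ℝ) (Λ Λ' : ℝ → Finset HexVertex)
    (m : ℝ → ℤ) (a b : ℝ → Sym2 HexVertex) (hρ : 0 < ρ)
    (hev : ∀ᶠ δ : ℝ in 𝓝[>] 0,
      Λ' δ ⊆ Λ δ ∧ hexDomainSimplyConnected (Λ δ) ∧ hexDomainSimplyConnected (Λ' δ) ∧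
      (hexGraph.induce (↑(Λ δ) : Set HexVertex)).Preconnected ∧
      (hexGraph.induce (↑(Λ' δ) : Set HexVertex)).Preconnected ∧
      a δ ∈ hexDomainBoundary (Λ δ) ∧ b δ ∈ hexDomainBoundary (Λ δ) ∧
      a δ ∈ hexDomainBoundary (Λ' δ) ∧ b δ ∈ hexDomainBoundary (Λ' δ) ∧
      Nonempty (HexMidEdgeSAW (Λ' δ) (a δ) (b δ)) ∧
      (∀ v ∈ Λ δ, (δ : ℂ) * hexCenter v ∈ D.carrier ∧ m δ ≤ v.1 1) ∧
      (∀ v ∈ Λ' δ, (δ : ℂ) * hexCenter v ∈ D'.carrier) ∧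
      (∀ v : HexVertex, (δ : ℂ) * hexCenter v ∈ ball (D.pt 0) ρ ∪ ball (D.pt 1) ρ →
        ((v ∈ Λ δ ↔ m δ ≤ v.1 1) ∧ (v ∈ Λ' δ ↔ m δ ≤ v.1 1))))
    (ha : Tendsto (fun δ : ℝ => (δ : ℂ) * hexMidpoint (a δ)) (𝓝[>] 0) (𝓝 (D.pt 0)))
    {ρ₂ η θ₀ θ₁ : ℝ} (hη : 0 ≤ η) (hρ₂ : 0 < ρ₂) (hρ₂ρ : ρ₂ ≤ ρ / 2) (hθ₁ : 0 < θ₁) (hθ₁₀ : θ₁ < θ₀)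
    (hθ₀ : θ₀ ≤ 1 / 2)
    (hW : ∀ᶠ δ : ℝ in 𝓝[>] 0, ∀ x : Site 2, x 1 = m δ → a δ = s((x - Pi.single 1 1, 1), (x, 0)) →
      ∑ d ∈ Finset.Icc ⌈θ₁ * (ρ₂ / δ)⌉ ⌊θ₀ * (ρ₂ / δ)⌋,
          (∑ γ : HexMidEdgeSAW (Λ δ) s((x - Pi.single 1 1, 1), (x, 0))
            s((x + Pi.single 0 d - Pi.single 1 1, 1), (x + Pi.single 0 d, 0)),
          if ∃ v ∈ γ.verts, ρ₂ / δ ≤ dist (hexCenter v) (hexMidpoint s((x - Pi.single 1 1, 1), (x, 0)))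
          then hexCriticalFugacity ^ γ.length else 0) ≤
        η * ∑ d ∈ Finset.Icc ⌈θ₁ * (ρ₂ / δ)⌉ ⌊θ₀ * (ρ₂ / δ)⌋,
          ∑ γ : HexMidEdgeSAW (Λ δ) s((x - Pi.single 1 1, 1), (x, 0))
            s((x + Pi.single 0 d - Pi.single 1 1, 1), (x + Pi.single 0 d, 0)),
          hexCriticalFugacity ^ γ.length) :
    ∀ᶠ δ : ℝ in 𝓝[>] 0, ∃ (x : Site 2) (d : ℤ),
      x 1 = m δ ∧ a δ = s((x - Pi.single 1 1, 1), (x, 0)) ∧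
      θ₁ * (ρ₂ / δ) ≤ (d : ℝ) ∧ (d : ℝ) ≤ θ₀ * (ρ₂ / δ) ∧
      (∀ v ∈ Λ δ, x 1 ≤ v.1 1) ∧ (∀ v ∈ Λ' δ, x 1 ≤ v.1 1) ∧
      s((x + Pi.single 0 d - Pi.single 1 1, 1), (x + Pi.single 0 d, 0)) ∈ hexDomainBoundary (Λ δ) ∧
      s((x + Pi.single 0 d - Pi.single 1 1, 1), (x + Pi.single 0 d, 0)) ∈ hexDomainBoundary (Λ' δ) ∧
      Nonempty (HexMidEdgeSAW (Λ δ) (a δ)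
        s((x + Pi.single 0 d - Pi.single 1 1, 1), (x + Pi.single 0 d, 0))) ∧
      Nonempty (HexMidEdgeSAW (Λ' δ) (a δ)
        s((x + Pi.single 0 d - Pi.single 1 1, 1), (x + Pi.single 0 d, 0))) ∧
      (1 - η) * (∑ γ : HexMidEdgeSAW (Λ δ) (a δ)
          s((x + Pi.single 0 d - Pi.single 1 1, 1), (x + Pi.single 0 d, 0)), hexCriticalFugacity ^ γ.length) ≤
        ∑ γ : HexMidEdgeSAW (Λ' δ) (a δ)
          s((x + Pi.single 0 d - Pi.single 1 1, 1), (x + Pi.single 0 d, 0)), hexCriticalFugacity ^ γ.length := by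
  set a₀ : ℂ := D.pt 0 with ha₀
  -- (A) floor form of `a δ`
  have hδρ : ∀ᶠ δ : ℝ in 𝓝[>] 0, δ < ρ := mem_nhdsWithin_of_mem_nhds (Iio_mem_nhds hρ)
  have e1 : ∀ᶠ δ : ℝ in 𝓝[>] 0, dist ((δ : ℂ) * hexMidpoint (a δ)) a₀ < ρ₂ / 2 :=
    Metric.tendsto_nhds.1 ha _ (by positivity)
  have hA : ∀ᶠ δ : ℝ in 𝓝[>] 0, ∃ x : Site 2, x 1 = m δ ∧ a δ = s((x - Pi.single 1 1, 1), (x, 0)) ∧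
      (x, (0 : Fin 2)) ∈ Λ δ ∧ (x, (0 : Fin 2)) ∈ Λ' δ ∧
      (x - Pi.single 1 1, (1 : Fin 2)) ∉ Λ δ ∧ (x - Pi.single 1 1, (1 : Fin 2)) ∉ Λ' δ := by
    have h1 : ∀ᶠ δ : ℝ in 𝓝[>] 0, dist ((δ : ℂ) * hexMidpoint (a δ)) a₀ < ρ / 2 :=
      Metric.tendsto_nhds.1 ha _ (half_pos hρ)
    filter_upwards [hev, h1, hδρ, self_mem_nhdsWithin] with δ hevδ h1 h2 hδ
    obtain ⟨-, -, -, -, -, haΛ, -, -, -, -, -, -, hrows⟩ := hevδ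
    exact floorEdge_data hδ h2 haΛ h1 fun v hv => hrows v (Or.inl hv)
  -- (B) eventual smallness of `δ`
  have e3 : ∀ᶠ δ : ℝ in 𝓝[>] 0, δ ≤ (θ₀ - θ₁) * ρ₂ :=
    mem_nhdsWithin_of_mem_nhds (Iic_mem_nhds (mul_pos (by linarith) hρ₂))
  have e4 : ∀ᶠ δ : ℝ in 𝓝[>] 0, δ < ρ₂ / 2 := mem_nhdsWithin_of_mem_nhds (Iio_mem_nhds (by positivity))
  filter_upwards [hev, hA, hW, e1, e3, e4, self_mem_nhdsWithin] with δ hevδ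
    ⟨x, hx1, hax, hx0Λ, hx0Λ', hxdΛ, hxdΛ'⟩ hWδ e1 e3 e4 hδ
  obtain ⟨hsubΛ, -, -, hconn, hconn', -, -, haΛ', -, -, hΛD, -, hrows⟩ := hevδ
  have hδ0 : (0 : ℝ) < δ := hδ
  have hrowsΛ : ∀ v ∈ Λ δ, x 1 ≤ v.1 1 := fun v hv => hx1 ▸ (hΛD v hv).2
  have hrowsΛ' : ∀ v ∈ Λ' δ, x 1 ≤ v.1 1 := fun v hv => hrowsΛ v (hsubΛ hv)
  -- the window inequality at the root cell `x`
  have hWx := hWδ x hx1 hax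
  -- the lattice radius `R = ρ₂ / δ`
  set R : ℝ := ρ₂ / δ with hRdef
  have hRpos : 0 < R := div_pos hρ₂ hδ0
  have hRδ : δ * R = ρ₂ := by rw [hRdef]; field_simp
  -- a lattice point within lattice distance `R` of `mid (a δ)` (plus one half) lies in the rigid ball
  have hball : ∀ v : HexVertex, dist (hexCenter v) (hexMidpoint (a δ)) ≤ R + 1 / 2 →
      (δ : ℂ) * hexCenter v ∈ ball a₀ ρ := by
    intro v hv
    rw [mem_ball]
    have h := dist_mesh_le hδ0.le hv e1.le
    have h' : δ * (R + 1 / 2) = ρ₂ + δ / 2 := by rw [mul_add, hRδ]; ring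
    calc dist ((δ : ℂ) * hexCenter v) a₀ ≤ δ * (R + 1 / 2) + ρ₂ / 2 := h
      _ = ρ₂ + δ / 2 + ρ₂ / 2 := by rw [h']
      _ < ρ := by linarith
  -- the window `S`
  set S : Finset ℤ := Finset.Icc ⌈θ₁ * R⌉ ⌊θ₀ * R⌋ with hS
  have hSiff : ∀ d : ℤ, d ∈ S ↔ (θ₁ * R ≤ (d : ℝ) ∧ (d : ℝ) ≤ θ₀ * R) := mem_window_iff θ₁ θ₀ R
  have hSne : S.Nonempty := by
    apply window_nonempty
    have h1 : (θ₀ - θ₁) * ρ₂ / δ ≥ 1 := by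
      rw [ge_iff_le, le_div_iff₀ hδ0, one_mul]; exact e3
    have h2 : (θ₀ - θ₁) * ρ₂ / δ = θ₀ * R - θ₁ * R := by rw [hRdef]; ring
    linarith
  -- facts about every window point
  have hpt : ∀ d ∈ S, 0 < d ∧
      (x + Pi.single 0 d, (0 : Fin 2)) ∈ Λ δ ∧ (x + Pi.single 0 d, (0 : Fin 2)) ∈ Λ' δ := by
    intro d hd
    obtain ⟨hd1, hd2⟩ := (hSiff d).1 hd
    have hdpos : (0 : ℝ) < d := lt_of_lt_of_le (mul_pos hθ₁ hRpos) hd1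
    have hd0 : 0 < d := by exact_mod_cast hdpos
    -- the inner endpoint is in the rigid ball
    have hin : (δ : ℂ) * hexCenter (x + Pi.single 0 d, (0 : Fin 2)) ∈ ball a₀ ρ := by
      apply hball
      have hedge : s((x + Pi.single 0 d - Pi.single 1 1, (1 : Fin 2)), (x + Pi.single 0 d, 0)) ∈
          hexGraph.edgeSet := (SimpleGraph.mem_edgeSet hexGraph).2 (adj_floorEdge _)
      have h1 := dist_hexCenter_hexMidpoint_le hedge (Sym2.mem_mk_right _ _)
      have h2 : dist (hexMidpoint s((x + Pi.single 0 d - Pi.single 1 1, (1 : Fin 2)), (x + Pi.single 0 d, 0)))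
          (hexMidpoint (a δ)) ≤ θ₀ * R := by
        rw [hax, dist_comm, dist_hexMidpoint_offset, abs_of_pos hdpos]; exact hd2
      have h3 : θ₀ * R ≤ R := by nlinarith
      have h4 := dist_triangle (hexCenter (x + Pi.single 0 d, (0 : Fin 2)))
        (hexMidpoint s((x + Pi.single 0 d - Pi.single 1 1, (1 : Fin 2)), (x + Pi.single 0 d, 0)))
        (hexMidpoint (a δ))
      linarith
    have hrow : m δ ≤ (x + Pi.single 0 d : Site 2) 1 := by
      rw [offsetCell_apply_one, hx1]
    exact ⟨hd0, (hrows _ (Or.inl hin)).1.2 hrow, (hrows _ (Or.inl hin)).2.2 hrow⟩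
  -- near region: a vertex of `Λ δ` closer than `R` to `mid (a δ)` lies in `Λ' δ`
  have hnear : ∀ v ∈ Λ δ, dist (hexCenter v) (hexMidpoint (a δ)) < R → v ∈ Λ' δ := by
    intro v hv hvd
    exact (hrows v (Or.inl (hball v (by linarith)))).2.2 (hΛD v hv).2
  have haΛ'mid : a δ ∈ hexDomainMidEdges (Λ' δ) := hexDomainBoundary_subset _ haΛ'
  -- the maximiser (abstract selection over the window, `Z_B := Z`)
  rw [hax] at haΛ'mid hnear
  obtain ⟨d, hdS, hdmax⟩ := exists_window_point_self hSne
    (Z := fun d => ∑ γ : HexMidEdgeSAW (Λ δ) s((x - Pi.single 1 1, 1), (x, 0))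
      s((x + Pi.single 0 d - Pi.single 1 1, 1), (x + Pi.single 0 d, 0)), hexCriticalFugacity ^ γ.length)
    (Z' := fun d => ∑ γ : HexMidEdgeSAW (Λ' δ) s((x - Pi.single 1 1, 1), (x, 0))
      s((x + Pi.single 0 d - Pi.single 1 1, 1), (x + Pi.single 0 d, 0)), hexCriticalFugacity ^ γ.length)
    (F := fun d => ∑ γ : HexMidEdgeSAW (Λ δ) s((x - Pi.single 1 1, 1), (x, 0))
      s((x + Pi.single 0 d - Pi.single 1 1, 1), (x + Pi.single 0 d, 0)),
        if ∃ v ∈ γ.verts, R ≤ dist (hexCenter v) (hexMidpoint s((x - Pi.single 1 1, 1), (x, 0)))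
        then hexCriticalFugacity ^ γ.length else 0)
    hη
    (fun d _ => archMass_le_archMass_add_farMass haΛ'mid hnear)
    hWx
  obtain ⟨hd0, hy0Λ, hy0Λ'⟩ := hpt d hdS
  obtain ⟨hd1, hd2⟩ := (hSiff d).1 hdS
  have hy1 : (x + Pi.single 0 d : Site 2) 1 = x 1 := offsetCell_apply_one x d
  have hyx : (x + Pi.single 0 d : Site 2) ≠ x := offsetCell_ne x hd0.ne'
  have hne : s((x - Pi.single 1 1, (1 : Fin 2)), (x, 0)) ≠
      s((x + Pi.single 0 d - Pi.single 1 1, 1), (x + Pi.single 0 d, 0)) := by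
    intro h
    have hmem : (x + Pi.single 0 d, (0 : Fin 2)) ∈ s((x - Pi.single 1 1, (1 : Fin 2)), (x, 0)) := by
      rw [h]; exact Sym2.mem_mk_right _ _
    rcases Sym2.mem_iff.1 hmem with h' | h'
    · exact (show (0 : Fin 2) ≠ 1 by decide) (congrArg Prod.snd h')
    · exact hyx (congrArg Prod.fst h')
  have hydΛ : (x + Pi.single 0 d - Pi.single 1 1, (1 : Fin 2)) ∉ Λ δ := floorEdge_down_not_mem hrowsΛ hy1
  have hydΛ' : (x + Pi.single 0 d - Pi.single 1 1, (1 : Fin 2)) ∉ Λ' δ := floorEdge_down_not_mem hrowsΛ' hy1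
  refine ⟨x, d, hx1, hax, hd1, hd2, hrowsΛ, hrowsΛ',
    floorEdge_mem_hexDomainBoundary hrowsΛ hy1 hy0Λ, floorEdge_mem_hexDomainBoundary hrowsΛ' hy1 hy0Λ',
    ?_, ?_, ?_⟩
  · rw [hax]
    exact nonempty_hexMidEdgeSAW_of_preconnected hconn (adj_floorEdge x) hxdΛ hx0Λ hydΛ hy0Λ hne
  · rw [hax]
    exact nonempty_hexMidEdgeSAW_of_preconnected hconn' (adj_floorEdge x) hxdΛ' hx0Λ' hydΛ' hy0Λ' hne
  · rw [hax]
    exact hdmax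

/-! ### Registered form -/

/-- **Registered sub-goal `stub_windowMaximiserOfWindowIneq`** (crux item stmt-CriticalPhenomena-0808, line
`root-locality-replaces-loewner`, lead continuation c6): the window maximiser of the bootstrap from the window
inequality along the discretisation families (`windowMaximiser_of_windowIneq`), signature fully qualified.
[cite: LawlerSchrammWerner2004SAW, §3.4 ("SAW satisfies restriction")] -/
theorem stub_windowMaximiserOfWindowIneq : ∀ (D D' : Literature.Probability.RandomPlanarGeometry.DobrushinDomain) (ρ : ℝ) (Λ Λ' : ℝ → Finset Literature.Probability.LatticeModels.HexVertex) (m : ℝ → ℤ) (a b : ℝ → Sym2 Literature.Probability.LatticeModels.HexVertex), 0 < ρ → (∀ᶠ δ : ℝ in nhdsWithin 0 (Set.Ioi 0), Λ' δ ⊆ Λ δ ∧ Literature.Probability.RandomPlanarGeometry.SAW.hexDomainSimplyConnected (Λ δ) ∧ Literature.Probability.RandomPlanarGeometry.SAW.hexDomainSimplyConnected (Λ' δ) ∧ (Literature.Probability.LatticeModels.hexGraph.induce (↑(Λ δ) : Set Literature.Probability.LatticeModels.HexVertex)).Preconnected ∧ (Literature.Probability.LatticeModels.hexGraph.induce (↑(Λ'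 δ) : Set Literature.Probability.LatticeModels.HexVertex)).Preconnected ∧ a δ ∈ Literature.Probability.RandomPlanarGeometry.SAW.hexDomainBoundary (Λ δ) ∧ b δ ∈ Literature.Probability.RandomPlanarGeometry.SAW.hexDomainBoundary (Λ δ) ∧ a δ ∈ Literature.Probability.RandomPlanarGeometry.SAW.hexDomainBoundary (Λ' δ) ∧ b δ ∈ Literature.Probability.RandomPlanarGeometry.SAW.hexDomainBoundary (Λ' δ) ∧ Nonempty (Literature.Probability.RandomPlanarGeometry.SAW.HexMidEdgeSAW (Λ' δ) (a δ) (b δ)) ∧ (∀ v ∈ Λ δ, (δ : ℂ) * Literature.Probability.LatticeModels.hexCenter v ∈ D.carrier ∧ m δ ≤ v.1 1) ∧ (∀ v ∈ Λ' δ, (δ : ℂ) * Literature.Probability.LatticeModels.hexCenter v ∈ D'.carrier) ∧ (∀ v : Literature.Probability.LatticeModels.HexVertex, (δ : ℂ) * Literature.Probability.LatticeModels.hexCenter v ∈ Metric.ball (D.pt 0) ρ ∪ Metric.ball (D.pt 1) ρ → ((v ∈ Λ δ ↔ m δ ≤ v.1 1) ∧ (v ∈ Λ' δ ↔ m δ ≤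 v.1 1)))) → Filter.Tendsto (fun δ : ℝ => (δ : ℂ) * Literature.Probability.RandomPlanarGeometry.SAW.hexMidpoint (a δ)) (nhdsWithin 0 (Set.Ioi 0)) (nhds (D.pt 0)) → ∀ (ρ₂ η θ₀ θ₁ : ℝ), 0 ≤ η → 0 < ρ₂ → ρ₂ ≤ ρ / 2 → 0 < θ₁ → θ₁ < θ₀ → θ₀ ≤ 1 / 2 → (∀ᶠ δ : ℝ in nhdsWithin 0 (Set.Ioi 0), ∀ x : Literature.Probability.LatticeModels.Site 2, x 1 = m δ → a δ = s((x - Pi.single 1 1, 1), (x, 0)) → ∑ d ∈ Finset.Icc ⌈θ₁ * (ρ₂ / δ)⌉ ⌊θ₀ * (ρ₂ / δ)⌋, (∑ γ : Literature.Probability.RandomPlanarGeometry.SAW.HexMidEdgeSAW (Λ δ) s((x - Pi.single 1 1, 1), (x, 0)) s((x + Pi.single 0 d - Pi.single 1 1, 1), (x + Pi.single 0 d, 0)), if ∃ v ∈ γ.verts, ρ₂ / δ ≤ dist (Literature.Probability.LatticeModels.hexCenter v) (Literature.Probability.RandomPlanarGeometry.SAW.hexMidpoint s((x - Pi.single 1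 1, 1), (x, 0))) then Literature.Probability.RandomPlanarGeometry.SAW.hexCriticalFugacity ^ γ.length else 0) ≤ η * ∑ d ∈ Finset.Icc ⌈θ₁ * (ρ₂ / δ)⌉ ⌊θ₀ * (ρ₂ / δ)⌋, ∑ γ : Literature.Probability.RandomPlanarGeometry.SAW.HexMidEdgeSAW (Λ δ) s((x - Pi.single 1 1, 1), (x, 0)) s((x + Pi.single 0 d - Pi.single 1 1, 1), (x + Pi.single 0 d, 0)), Literature.Probability.RandomPlanarGeometry.SAW.hexCriticalFugacity ^ γ.length) → ∀ᶠ δ : ℝ in nhdsWithin 0 (Set.Ioi 0), ∃ (x : Literature.Probability.LatticeModels.Site 2) (d : ℤ), x 1 = m δ ∧ a δ = s((x - Pi.single 1 1, 1), (x, 0)) ∧ θ₁ * (ρ₂ / δ) ≤ (d : ℝ) ∧ (d : ℝ) ≤ θ₀ * (ρ₂ / δ) ∧ (∀ v ∈ Λ δ, x 1 ≤ v.1 1) ∧ (∀ v ∈ Λ' δ, x 1 ≤ v.1 1) ∧ s((x + Pi.single 0 d - Pi.single 1 1, 1), (x + Pi.single 0 d, 0)) ∈ Literature.Probability.RandomPlanarGeometry.SAW.hexDomainBoundary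 (Λ δ) ∧ s((x + Pi.single 0 d - Pi.single 1 1, 1), (x + Pi.single 0 d, 0)) ∈ Literature.Probability.RandomPlanarGeometry.SAW.hexDomainBoundary (Λ' δ) ∧ Nonempty (Literature.Probability.RandomPlanarGeometry.SAW.HexMidEdgeSAW (Λ δ) (a δ) s((x + Pi.single 0 d - Pi.single 1 1, 1), (x + Pi.single 0 d, 0))) ∧ Nonempty (Literature.Probability.RandomPlanarGeometry.SAW.HexMidEdgeSAW (Λ' δ) (a δ) s((x + Pi.single 0 d - Pi.single 1 1, 1), (x + Pi.single 0 d, 0))) ∧ (1 - η) * (∑ γ : Literature.Probability.RandomPlanarGeometry.SAW.HexMidEdgeSAW (Λ δ) (a δ) s((x + Pi.single 0 d - Pi.single 1 1, 1), (x + Pi.single 0 d, 0)), Literature.Probability.RandomPlanarGeometry.SAW.hexCriticalFugacity ^ γ.length) ≤ ∑ γ : Literature.Probability.RandomPlanarGeometry.SAW.HexMidEdgeSAW (Λ' δ) (a δ) s((x + Pi.single 0 d - Pi.single 1 1, 1), (x + Pi.single 0 d, 0)), Literature.Probability.RandomPlanarGeometry.SAW.hexCriticalFugacity ^ γ.length 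:=
  fun D D' ρ Λ Λ' m a b hρ hev ha _ _ _ _ hη hρ₂ hρ₂ρ hθ₁ hθ₁₀ hθ₀ hW =>
    windowMaximiser_of_windowIneq D D' ρ Λ Λ' m a b hρ hev ha hη hρ₂ hρ₂ρ hθ₁ hθ₁₀ hθ₀ hW

end Summit.CriticalPhenomena.SAWScalingLimit.Theorems.HexConjecture.RootLocality

end
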